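import Summits.QuantumFields.YangMills.Theorems.UnitScaleTiltHistoryTailBoundedHeight
import Summits.QuantumFields.YangMills.Theorems.UnitScaleTiltHistoryTailPerPlaquetteV3b
import HarnessLib

/-!
# BC3 birth skeleton v4 («R2 cut», α REMOVED) — crux `HistoryTail` (route `UnitScaleTilt`, item stmt-QuantumFields-18916, K2)

Cell `ym3-torus` (rung R3), seat `ym3-torus-plan` gen 13 (route owner), 2026-08-26.  Supersedes the registered v3b
(`HOME/route-R3/ym/plan-g11/HistoryTail_birth_v3b.lean`, sha16 `cf09887d813eb370`; stubs `stub_alpha` / `stub_perPlaquetteOfAlpha` /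
`stub_tailOfPerPlaquette`).

WHY v4 (owner ruling of 2026-08-26 ~11:17Z on the fleet lead's finding `FINDING-18916-alpha-idle.md`, af2a5b6fdc02c5ee — CONFIRMED):
the hypothesis `AlphaInputs3D.AtScale L` of v3b's hard stub is MATHEMATICALLY IDLE — `Summit.QuantumFields.YangMills.Theorems.AlphaInputs3D`
∃-binds Bałaban's external-input package `X : ExternalInputs S G` whose block averaging `X.av` is FREE (the lane's only instance
`ExternalInputs.ofStd` is the axial `AveragingRT.stdAvg`), while the crux's event and Gibbs measure are pinned to the EML averaging
`BlockAveraging.blockAvg ℰp`; after ∃-elimination nothing relates the two, so (α) transfers nothing to the stub.  Pinning the package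
(`X.av := blockAvg ℰp`, «R1») is not adoptable today: the lane's carrier demands EXACT Haar compatibility `av_map` (load-bearing in
`Balaban3D/Proofs/Transport48.lean` T1 = 1, `Bound55Masses/Tower/Std` `hmap`), which for the non-linear (0.4)/EML averaging is neither in
print nor in the tree (tree: absolute continuity only, `T3UnitLawDensityEML.haarAC_blockAvg`) and is possibly FALSE — a pinned ∃-package
could be vacuous.  Hence R2: (α) LEAVES the skeleton; it re-enters only through an OUTPUT- or AC-level socket requested from pub-balaban3d
(WANTED of the same ruling).  v4 =

* landed S0 (p438760, fleet lead ym-ust-18916-p1): `HistoryTailBoundedHeight.perPlaquette_of_split` — the per-plaquette schema `PP`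
  for ALL heights `1 ≤ j ≤ K` from a high-height piece `j₀ < j ≤ K` (bounded heights `j ≤ j₀` are a theorem:
  `unitScaleTilt_perPlaquette_boundedHeight`, bare Wilson weight + `blockAvg_near_one`, constants depending on `j₀`) — CONSUMED BY NAME;
* landed p432346 (`HistoryTailBirthV3b.stub_tailOfPerPlaquette`, = v3b's third stub, credited): `PP → AveragedTailAt` — CONSUMED BY NAME;
* `stub_perPlaquetteHighRaw` (HARDEST, XXL, HONESTLY UNCONDITIONAL — K2's located, unprinted renormalisation-group content): for every
  admissible block size `L` a profile `(b₀, p₀)` together with Bałaban's collar exponents `(r₀, κ)`, `p₀ > 1 + 3r₀/2`, a threshold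
  `γ₁ ≤ 1`, and for every family `F.L = L`, `0 < γ ≤ γ₁` a height `j₀` and constants `C ≥ 0`, `A` with, for all `K`, `j₀ < j ≤ K`,
  `p ∈ Plaq_j`:  `Gibbs_K{θ(K−j) ≤ |Ū^{j}(∂p) − 1|} ≤ C·β_{K−j}^A·exp(−¼p(g_{K−j})² + κ·x(g_{K−j})^{2+3r₀})`, `x(g) = 1 + log g⁻¹` —
  the RAW currency of print: the small factor `exp(−¼p(g_j)²)` of (71) p.273 per UV-large averaged plaquette inside the full
  representation (41) p.266 of the averaged density (numerator) against the lower bound (47) p.267 (denominator), the bulk terms cancelling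
  up to `exp(O(1)·Vol)` (in `C = C(F, γ)`), and the collar cost `Σ_{i ≥ j} O(log g_i⁻¹)·|Z_i| ≍ κ·x(g_j)^{2+3r₀}` of the large-field
  regions a scale-`j` large plaquette forces at all later scales (gap G-B10-02 of `Literature/…/B10.lean`).  Sub-structure foreseen
  (lead's `CARD-18916-K2-split.md`): S1 density transfer to the tilt picture (`T3TiltDescent.integral_map_descendTo_restrict`, M) ·
  S2 an (α)-socket pinned to `blockAvg ℰp` at AC level (CONSTRUCTION, pub-balaban3d WANTED) · S3 numerator (41)+(71) · S4 denominator (47) ·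
  S5 decoupling of the bulk outside the collar (Peierls-in-RG; printed only for d = 4 small field [Balaban1989LargeFieldII] and abelian
  d = 3 [King1986 §4]) — re-cut into registered pieces the day S2 exists.  Why it might fail: the tree's event (`dist1` of the averaged
  plaquette ≥ θ) is weaker than Bałaban's small-field conditions (39) with covariant derivatives (then a derivative profile is needed and
  K2 is restated, same glue); S5 is located-unprinted in d = 3 non-abelian.
* `stub_budget` (M, pure real analysis, provable TODAY): the G-B10-02 budget closes for `p₀ > 1 + 3r₀/2`:
  `exp(−¼p(g)² + κ·x(g)^{2+3r₀}) ≤ C·exp(−c·p(g)²)` on `0 < g ≤ 1` (`p(g) = b₀x(g)^{p₀}`, `x ≥ 1`, `2p₀ > 2 + 3r₀`; e.g. `c = ⅛`).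
`HistoryTail_of` threads them SORRY-FREE into the route decl `Summit.QuantumFields.YangMills.Theses.UnitScaleTilt.HistoryTail`:
raw high piece × budget ⇒ `hhigh` of `perPlaquette_of_split` ⇒ `PP` ⇒ `AveragedTailAt` (p432346) ⇒ `HistoryTailAt`
(`T3BareTailProfile.historyTailAt_of_averagedTailAt`, bare height inside).  [cite: Balaban1985UV3, (7) p.257, (41) p.266, (47) p.267,
(67)–(71) p.273; Balaban1989LargeFieldII, Thm 1 p.357; King1986, Thm 4.1]
-/

set_option autoImplicit false

noncomputable section

open Literature.MathematicalPhysics.QuantumFieldTheory.Balaban1983to89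
open Literature.MathematicalPhysics.QuantumFieldTheory.Balaban1983to89.T3ContinuumYM3Torus
open Literature.MathematicalPhysics.QuantumFieldTheory.Balaban1983to89.T3UnitScaleTilt
open Literature.MathematicalPhysics.QuantumFieldTheory.Balaban1983to89.T3UnitLawDensityEML
open Literature.MathematicalPhysics.QuantumFieldTheory.Balaban1983to89.T3CruxEstimates
open Literature.MathematicalPhysics.QuantumFieldTheory.Balaban1983to89.T3BareTailProfile
open Literature.MathematicalPhysics.QuantumFieldTheory.Balaban1983to89.T3Thresholds
open Literature.MathematicalPhysics.QuantumFieldTheory.Balaban1983to89.T3ThresholdSmallness (sqrt_coupling_pos_le)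
open Summit.QuantumFields.YangMills.Theorems

namespace Summit.QuantumFields.YangMills.Cruxes.HistoryTail.BirthV4

/-! ## §1 Registered stubs (sorries live ONLY here) -/

/-- STUB 1 (HARDEST, XXL, unconditional) — the PER-PLAQUETTE large-field Gibbs tail of the block-AVERAGED fields at all HIGH heights
`j₀ < j ≤ K`, in print's RAW currency `C·β_{K−j}^A·exp(−¼p(g_{K−j})² + κ·x(g_{K−j})^{2+3r₀})` ((71) small factor inside the full
representation (41)/(47) of `ρ_j` + the collar cost of G-B10-02), with the collar exponents `(r₀, κ)` exposed and `p₀ > 1 + 3r₀/2`.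
[cite: Balaban1985UV3, (41) p.266, (47) p.267, (67)-(71) p.273; Balaban1989LargeFieldII, Thm 1 p.357; King1986, Thm 4.1] -/
theorem stub_perPlaquetteHighRaw :
    ∀ (L : ℕ), Odd L → 1 < L →
      ∃ r₀ κ b₀ p₀ γ₁ : ℝ, 0 ≤ r₀ ∧ 0 ≤ κ ∧ 0 < b₀ ∧ 2 < p₀ ∧ 1 + 3 * r₀ / 2 < p₀ ∧ 0 < γ₁ ∧ γ₁ ≤ 1 ∧
        ∀ (F : T3Family) (γ : ℝ), F.L = L → 0 < γ → γ ≤ γ₁ →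
          ∃ (j₀ : ℕ) (C : ℝ) (A : ℕ), 0 ≤ C ∧
            ∀ (K j : ℕ), j₀ < j → j ≤ K → ∀ p : Plaq (F.P K) j,
              (gibbsK F ℰp γ K).real
                  {U | θBal F.L γ b₀ p₀ (K - j) ≤
                    GaugeGroup.dist1 (GaugeField.plaqHol
                      (Averaging.iter (fun _ => BlockAveraging.blockAvg ℰp) j U) p)} ≤
                C * (F.scheme ℰp γ).β (K - j) ^ A *
                  Real.exp (-(B10.pFun b₀ p₀ (Real.sqrt (γ * ((F.L : ℝ)⁻¹) ^ (K - j))) ^ 2 / 4) +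
                    κ * (1 + Real.log (Real.sqrt (γ * ((F.L : ℝ)⁻¹) ^ (K - j)))⁻¹) ^ (2 + 3 * r₀)) := by
  sorry

/-- STUB 2 (M, pure real analysis, provable now) — the G-B10-02 BUDGET: for `p₀ > 1 + 3r₀/2` the collar cost `κ·x(g)^{2+3r₀}` is
absorbed by half of the Gaussian-in-`p(g)` small factor, uniformly on `0 < g ≤ 1` (`x(g) = 1 + log g⁻¹ ≥ 1`, `p(g) = b₀x(g)^{p₀}`).
[cite: Balaban1985UV3, (7) p.257 and (71) p.273] -/
theorem stub_budget :
    ∀ (b₀ p₀ r₀ κ : ℝ), 0 < b₀ → 0 ≤ r₀ → 0 ≤ κ → 1 + 3 * r₀ / 2 < p₀ →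
      ∃ C c : ℝ, 0 ≤ C ∧ 0 < c ∧ ∀ g : ℝ, 0 < g → g ≤ 1 →
        Real.exp (-(B10.pFun b₀ p₀ g ^ 2 / 4) + κ * (1 + Real.log g⁻¹) ^ (2 + 3 * r₀)) ≤
          C * Real.exp (-(c * B10.pFun b₀ p₀ g ^ 2)) := by
  sorry

/-! ## §2 The composition — concludes the ROUTE DECL by name; consumes the two stubs and the LANDED pieces p438760 / p432346; no sorry -/

/-- **`HistoryTail ⇐ stub_perPlaquetteHighRaw ∧ stub_budget`** (+ landed `perPlaquette_of_split` (p438760), `stub_tailOfPerPlaquette`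
(p432346) and `historyTailAt_of_averagedTailAt`). -/
theorem HistoryTail_of : Summit.QuantumFields.YangMills.Theses.UnitScaleTilt.HistoryTail := by
  intro L m hm
  by_cases hL : Odd L ∧ 1 < L
  · obtain ⟨r₀, κ, b₀, p₀, γ₁, hr₀, hκ, hb, hp2, hp, hγ₁, hγ₁1, h⟩ := stub_perPlaquetteHighRaw L hL.1 hL.2
    obtain ⟨C₆, c, hC₆, hc, hbud⟩ := stub_budget b₀ p₀ r₀ κ hb hr₀ hκ hp
    refine ⟨b₀, p₀, γ₁, hb, hp2, hγ₁, fun F γ hFL hγ hle => ?_⟩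
    have hγ1 : γ ≤ 1 := hle.trans hγ₁1
    have hp1 : (1 : ℝ) ≤ p₀ := by linarith
    have hL1 : 1 ≤ F.L := F.hL.2.le
    obtain ⟨j₀, C, A, hC, hhigh⟩ := h F γ hFL hγ hle
    have hhigh' : ∃ (C : ℝ) (A : ℕ) (c : ℝ), 0 ≤ C ∧ 0 < c ∧
        ∀ (K j : ℕ), j₀ < j → j ≤ K → ∀ p : Plaq (F.P K) j,
          (gibbsK F ℰp γ K).real
              {U | θBal F.L γ b₀ p₀ (K - j) ≤
                GaugeGroup.dist1 (GaugeField.plaqHol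
                  (Averaging.iter (fun _ => BlockAveraging.blockAvg ℰp) j U) p)} ≤
            C * (F.scheme ℰp γ).β (K - j) ^ A *
              Real.exp (-(c * B10.pFun b₀ p₀ (Real.sqrt (γ * ((F.L : ℝ)⁻¹) ^ (K - j))) ^ 2)) := by
      refine ⟨C * C₆, A, c, mul_nonneg hC hC₆, hc, fun K j hj hjK p => ?_⟩
      have hg := sqrt_coupling_pos_le hL1 hγ (K - j)
      have hg1 := coupling_le_one hL1 hγ hγ1 (K - j)
      have hβA : 0 ≤ C * (F.scheme ℰp γ).β (K - j) ^ A :=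
        mul_nonneg hC (pow_nonneg (F.scheme_β_nonneg ℰp hγ.le (K - j)) A)
      calc (gibbsK F ℰp γ K).real
              {U | θBal F.L γ b₀ p₀ (K - j) ≤
                GaugeGroup.dist1 (GaugeField.plaqHol
                  (Averaging.iter (fun _ => BlockAveraging.blockAvg ℰp) j U) p)}
            ≤ C * (F.scheme ℰp γ).β (K - j) ^ A *
                Real.exp (-(B10.pFun b₀ p₀ (Real.sqrt (γ * ((F.L : ℝ)⁻¹) ^ (K - j))) ^ 2 / 4) +
                  κ * (1 + Real.log (Real.sqrt (γ * ((F.L : ℝ)⁻¹) ^ (K - j)))⁻¹) ^ (2 + 3 * r₀)) := hhigh K j hj hjK p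
        _ ≤ C * (F.scheme ℰp γ).β (K - j) ^ A *
                (C₆ * Real.exp (-(c * B10.pFun b₀ p₀ (Real.sqrt (γ * ((F.L : ℝ)⁻¹) ^ (K - j))) ^ 2))) :=
              mul_le_mul_of_nonneg_left (hbud _ hg.1 hg1) hβA
        _ = C * C₆ * (F.scheme ℰp γ).β (K - j) ^ A *
                Real.exp (-(c * B10.pFun b₀ p₀ (Real.sqrt (γ * ((F.L : ℝ)⁻¹) ^ (K - j))) ^ 2)) := by ring
    have hPP := HistoryTailBoundedHeight.perPlaquette_of_split j₀ F hγ hγ1 hb.le p₀ hhigh'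
    exact historyTailAt_of_averagedTailAt F hγ hγ1 hb hp1 hm
      (HistoryTailBirthV3b.stub_tailOfPerPlaquette F γ b₀ p₀ hγ hγ1 hb hp1 hPP)
  · refine ⟨1, 3, 1, one_pos, by norm_num, one_pos, fun F γ hFL _ _ => ?_⟩
    have hF := F.hL
    rw [hFL] at hF
    exact (hL hF).elim

end Summit.QuantumFields.YangMills.Cruxes.HistoryTail.BirthV4

end
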